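import Summits.HodgeConjecture.HodgeConjecture.Theses.PadicSemiregularLift
import Summits.HodgeConjecture.HodgeConjecture.Theses.QbarEnvelope
import Summits.HodgeConjecture.HodgeConjecture.Theorems.PadicSemiregularLiftAnchorsAtGenericHodgeLocusPointsFermatAnchorReduction
import Summits.HodgeConjecture.HodgeConjecture.Theorems.PadicSemiregularLiftHodgeAbelianVarietiesStarSeedsEngine
import Literature.AlgebraicGeometry.Crystalline.PadicAnchorDefs

/-!
# Crux `HodgeBeyondAnchors` (stmt-HodgeConjecture-14054) — line `IdeatorFiveSketch`
# (card `coherent-plane-object-engine`): the lead's skeleton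

Route `PadicSemiregularLift`.  Composition (`HodgeBeyondAnchors_of`, bottom of the file):

  QbarEnvelope.Envelope (stmt-1069) ∧ QbarEnvelope.PullbackAlgebraic (stmt-1071) ∧ QbarEnvelope.HodgeModels (PROVED)
    ⟹ [funnel, `hodgeBeyondAnchors_of_funnel`]  it suffices to prove `QbarEnvelope.HCOverNumberFields`
      (HC for every smooth projective complex `X` with a number-field model);
  for such `X`:  `stub_numberFieldSeeds` gives a GENUINE PLACE PACKAGE `D : Place n X` (a prime `p > n + 6`,
    a finite residue field `k`, a `W(k)`-model `𝒴` of `X` with the standing hypotheses of the route crux P1a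
    `FormalLiftingFromClassLifting` VERBATIM (`PadicAnchor.ModelHypotheses`), a crystalline realization `C` with
    the Bloch–Esnault–Kerz predicate, a period comparison `cmp`) at which every COHERENT class (`IsCoherentAt`:
    in `Fʳ` and in `bo (K · Tate)`) is SEED-SPANNED (`CoherentSeedsAt`: `K`-combination of `bo chᵣ` of
    `{0,1}`-semiregular finite locally free seeds with the BEK Hodge condition) — the card's ONE new statement;
  `stub_hodgeClassesCoherent` says the rational `(r,r)`-classes of `X` lie in the `ℂ`-span of the periods of the
    coherent classes at every genuine place (the place-package transport of AdelicCoherence's cruxes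
    `DeRhamPlanes` stmt-13697 ∧ `FrobeniusPlanes` stmt-13695 = Ogus's Hopes 4.11.1/4.11.2; consumed by name only
    once the card's bridge D1 is a defs module);
  the route's ENGINE, consumed BY NAME as registered hypotheses — P1b `PadicPridhamSemiregularity` (⋆ from
    `{0,1}`-semiregularity), P1a `FormalLiftingFromClassLifting` (+ `BlochEsnaultKerzLifting C` ⇒ `LiftsFormally`),
    P3a `FormalVectorBundlesAlgebraize` (⇒ `LiftsTo`) — makes every seed lift to `𝒴`, so `bo chᵣ(seed)` is an
    algebraic de Rham class of the generic fibre (`coherent_mem_span_ratAlgebraicClasses`, PROVED), whose period is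
    an algebraic Betti class (`IsGenuine.cycleCompatible`); spans are respected (`semilinear_apply_mem_span_image`),
    so every rational `(r,r)`-class is algebraic: `hodgeConjectureFor_of_place` (PROVED).

Stubs (sorried, registered): `stub_hodgeClassesCoherent`, `stub_numberFieldSeeds`.  Registered hypotheses of
`HodgeBeyondAnchors_of` (route items by name): Envelope, PullbackAlgebraic, PadicPridhamSemiregularity,
FormalLiftingFromClassLifting, FormalVectorBundlesAlgebraize.
-/

set_option linter.dupNamespace false

noncomputable section

open CategoryTheory AlgebraicGeometry
open scoped Isocrystal
open Literature.AlgebraicGeometry Literature.AlgebraicGeometry.Motives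
  Literature.AlgebraicGeometry.Motives.WittScheme Literature.AlgebraicGeometry.HodgeTheory
  Literature.AlgebraicGeometry.Crystalline Literature.AlgebraicGeometry.KTheory
open Summit.HodgeConjecture.HodgeConjecture.Theses
open Summit.HodgeConjecture.HodgeConjecture.Theses.PadicSemiregularLift

namespace Summit.HodgeConjecture.HodgeConjecture.Cruxes.HodgeBeyondAnchors.CoherentPlaneObjectEngine

/-! ### §1 Model-wise vocabulary (the card's Sketch, verbatim) -/

section Model

variable {p : ℕ} [Fact p.Prime] {k : Type} [Field k] [CharP k p] [PerfectRing k p]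

/-- **Seed span at one model**: `α ∈ H²ʳ_dR(X_K/K)` lies in the `K`-span of the Berthelot–Ogus images of
`chᵣ^cris` of finitely many finite locally free, `{0,1}`-semiregular seeds on the special fibre satisfying the
Bloch–Esnault–Kerz Hodge condition at `𝒳`. -/
def SemiregularSeedSpanAt (C : CrystallineRealization p k) (𝒳 : SchemeOver (WittVector p k))
    (r : ℕ) (α : C.dR.obj (genericFibre 𝒳) (2 * r)) : Prop :=
  ∃ s : Finset (specialFibre 𝒳).left.Modules,
    (∀ E ∈ s, ∃ hE : IsFiniteLocallyFree E, IsZeroOneSemiregular hE ∧ C.HodgeCondition 𝒳 E) ∧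
    α ∈ Submodule.span K(p, k)
      ((fun E => C.bo 𝒳 (2 * r) (C.chCris (specialFibre 𝒳) E r)) '' (s : Set _))

/-- **Coherent class at one model**: `α` lies in `Fʳ H²ʳ_dR(X_K/K)` and in the image under the Berthelot–Ogus map
of the `K`-span of the crystalline Tate classes (`φ x = pʳ x`) of the special fibre. -/
def IsCoherentAt (C : CrystallineRealization p k) (𝒳 : SchemeOver (WittVector p k)) (r : ℕ)
    (α : C.dR.obj (genericFibre 𝒳) (2 * r)) : Prop :=
  α ∈ C.dR.fil (2 * r) r ∧
    α ∈ (Submodule.span K(p, k) (C.tateClasses (specialFibre 𝒳) r : Set _)).map (C.bo 𝒳 (2 * r))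

/-- **The card's new statement at one model**: every coherent class of degree `2r` is seed-spanned. -/
def CoherentSeedsAt (C : CrystallineRealization p k) (𝒳 : SchemeOver (WittVector p k)) (r : ℕ) : Prop :=
  ∀ α : C.dR.obj (genericFibre 𝒳) (2 * r), IsCoherentAt C 𝒳 r α → SemiregularSeedSpanAt C 𝒳 r α

/-- **Seeds ⇒ coherent** (necessity; the stub asks nothing absurd). [cite: BlochEsnaultKerz2014pAdic, §2 (2.11)–(2.12)] -/
theorem isCoherentAt_of_seedSpan (C : CrystallineRealization p k) {n : ℕ}
    {𝒳 : SchemeOver (WittVector p k)} (h𝒳 : IsSmoothProperModel n 𝒳) {r : ℕ}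
    {α : C.dR.obj (genericFibre 𝒳) (2 * r)} (h : SemiregularSeedSpanAt C 𝒳 r α) :
    IsCoherentAt C 𝒳 r α := by
  obtain ⟨s, hs, hα⟩ := h
  refine ⟨(Submodule.span_le.mpr ?_) hα, (Submodule.span_le.mpr ?_) hα⟩
  · rintro _ ⟨E, hEs, rfl⟩
    obtain ⟨-, -, hH⟩ := hs E hEs
    exact hH r
  · rintro _ ⟨E, -, rfl⟩
    refine Submodule.mem_map_of_mem (Submodule.subset_span ?_)
    exact C.frobK_chCris h𝒳.isSmoothProjective_specialFibre E r

/-- **Engine output at one model**: if every coherent class is seed-spanned and every `{0,1}`-semiregular seed with the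
Hodge condition lifts to `𝒳`, then every coherent class is a `K`-combination of `ℚ`-algebraic de Rham classes of the
generic fibre. [cite: BerthelotOgus1983, Rem. 3.7.1] -/
theorem coherent_mem_span_ratAlgebraicClasses (C : CrystallineRealization p k) {n : ℕ}
    {𝒳 : SchemeOver (WittVector p k)} (h𝒳 : IsSmoothProperModel n 𝒳) {r : ℕ}
    (hseeds : CoherentSeedsAt C 𝒳 r)
    (hlift : ∀ (E : (specialFibre 𝒳).left.Modules) (hE : IsFiniteLocallyFree E),
      IsZeroOneSemiregular hE → C.HodgeCondition 𝒳 E → LiftsTo 𝒳 E)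
    {α : C.dR.obj (genericFibre 𝒳) (2 * r)} (hα : IsCoherentAt C 𝒳 r α) :
    α ∈ Submodule.span K(p, k)
      (C.dR.ratAlgebraicClasses (genericFibre 𝒳) r : Set (C.dR.obj (genericFibre 𝒳) (2 * r))) := by
  obtain ⟨s, hs, hαs⟩ := hseeds α hα
  refine (Submodule.span_le.mpr ?_) hαs
  rintro _ ⟨E, hEs, rfl⟩
  obtain ⟨hE, hsr, hH⟩ := hs E hEs
  obtain ⟨E', hE', ⟨e⟩⟩ := hlift E hE hsr hH
  refine Submodule.subset_span ?_
  show C.bo 𝒳 (2 * r) (C.chCris (specialFibre 𝒳) E r) ∈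
    (C.dR.ratAlgebraicClasses (genericFibre 𝒳) r : Set (C.dR.obj (genericFibre 𝒳) (2 * r)))
  rw [← C.chCris_congr e r, C.bo_chCris h𝒳 E' hE' r]
  exact C.chDR_mem_ratAlgebraicClasses h𝒳.isSmoothProjective_genericFibre _ r

/-- **The route's engine BY NAME** gives the lifting hypothesis of `coherent_mem_span_ratAlgebraicClasses` on a model
with P1a's standing hypotheses: P1b (`{0,1}`-semiregular ⇒ (⋆)), Bloch–Esnault–Kerz Thm 1.3 (`BlochEsnaultKerzLifting C`)
+ P1a ((⋆) + rational pro-class lift ⇒ `LiftsFormally`), P3a (`LiftsFormally ⇒ LiftsTo`).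
[cite: BlochEsnaultKerz2014pAdic, Thm. 1.3] -/
theorem liftsTo_of_engine (h1b : PadicPridhamSemiregularity) (h1a : FormalLiftingFromClassLifting)
    (h3a : FormalVectorBundlesAlgebraize) (C : CrystallineRealization p k) (hBEK : BlochEsnaultKerzLifting C)
    {d : ℕ} {𝒳 : SchemeOver (WittVector p k)} (hM : PadicAnchor.ModelHypotheses d 𝒳)
    (E : (specialFibre 𝒳).left.Modules) (hE : IsFiniteLocallyFree E) (hsr : IsZeroOneSemiregular hE)
    (hH : C.HodgeCondition 𝒳 E) : LiftsTo 𝒳 E :=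
  h3a p k d 𝒳 hM.smoothProper E
    (HodgeAbelianVarieties.InnerFormInvariantSeeds.Engine.liftsFormally_of_hodgeCondition_of_star h1a C hBEK
      hM.smoothProper hM.projective hM.large hM.torsionFree_structureSheaf hM.torsionFree_hodgeOne
      hM.cotangent_free E hE hH (h1b p k d 𝒳 hM.smoothProper E hE hsr))

end Model

/-! ### §2 Place packages of a complex variety (real ↔ p-adic carriers; pattern of `PadicAnchor.Anchor`) -/

/-- A **place package** of a complex `n`-fold `X`: a prime `p`, a FINITE residue field `k` (so that the `K`-span of
the semilinear Tate classes is the genuine Frobenius eigenspace, TRIAGE-r1-2 §T1), a `W(k)`-model `𝒴` carrying the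
standing hypotheses of the route crux P1a VERBATIM (`PadicAnchor.ModelHypotheses n 𝒴`: smooth proper of relative
dimension `n`, projective over `W`, `n + 6 < p`, `H^b(𝒪)`/`H^b(Ω¹)` `p`-torsion-free, `n ≤ 3 ∨ Ω¹ free`), a crystalline
realization `C` over `k` with the Bloch–Esnault–Kerz predicate, and a complex embedding `ι : K → ℂ` with
`X ≅ 𝒴_K ⊗_ι ℂ` and a period comparison `cmp`. INTERFACE ONLY; which values are meant is said by `IsGenuine`. -/
structure Place (n : ℕ) (X : SchemeOver ℂ) where
  /-- the residue characteristic -/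
  p : ℕ
  [prime : Fact p.Prime]
  /-- the residue field (intended: `𝔽_v`, finite) -/
  k : Type
  [field : Field k]
  [charP : CharP k p]
  [perfect : PerfectRing k p]
  [finite : Finite k]
  /-- the model over `W(k)` -/
  𝒴 : SchemeOver (WittVector p k)
  /-- P1a's standing hypotheses on the model, verbatim -/
  hyp : PadicAnchor.ModelHypotheses n 𝒴
  /-- crystalline realization over `k` (intended: the classical one) -/
  C : CrystallineRealization p k
  /-- Bloch–Esnault–Kerz Thm 1.3 for `C` (named-fact predicate) -/
  bek : BlochEsnaultKerzLifting C
  /-- the complex embedding of `K = W(k)[1/p]` -/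
  ι : K(p, k) →+* ℂ
  /-- `X ≅ 𝒴_K ⊗_ι ℂ` -/
  iso : Nonempty (X ≅ (baseChangeHom ι).obj (genericFibre 𝒴))
  /-- period comparison (intended: algebraic de Rham theorem + GAGA + base change along `ι` and `iso`) -/
  cmp : ∀ i : ℕ, C.dR.obj (genericFibre 𝒴) i →ₛₗ[ι] complexBetti X i

attribute [instance] Place.prime Place.field Place.charP Place.perfect Place.finite

namespace Place

variable {n : ℕ} {X : SchemeOver ℂ}

/-- **Genuineness** of a place package: the classical comparison facts the composition consumes (period isomorphism;
periods of algebraic de Rham classes are algebraic Betti classes; periods of `Fʳ` are of Hodge level `≥ r`). -/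
structure IsGenuine (D : Place n X) : Prop where
  /-- `ℂ · cmp (H_dR) = H_B` -/
  periodSpan : ∀ i : ℕ, Submodule.span ℂ (Set.range (D.cmp i)) = ⊤
  /-- `cmp` is injective -/
  periodInjective : ∀ i : ℕ, Function.Injective (D.cmp i)
  /-- the period of an algebraic de Rham class lies in `algebraicClasses X r = Nʳ H²ʳ` -/
  cycleCompatible : ∀ (r : ℕ) (x : D.C.dR.obj (genericFibre D.𝒴) (2 * r)),
    x ∈ D.C.dR.ratAlgebraicClasses (genericFibre D.𝒴) r → D.cmp (2 * r) x ∈ algebraicClasses X r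
  /-- `cmp (Fʳ H²ʳ_dR) ⊆ Fʳ H²ʳ_B` -/
  filCompatible : ∀ (r : ℕ) (x : D.C.dR.obj (genericFibre D.𝒴) (2 * r)),
    x ∈ D.C.dR.fil (2 * r) r → D.cmp (2 * r) x ∈ PadicAnchor.bettiHodgeFil n X r

/-- The periods of the coherent classes of degree `2r` at the place. -/
def coherentImage (D : Place n X) (r : ℕ) : Set (complexBetti X (2 * r)) :=
  D.cmp (2 * r) '' {α | IsCoherentAt D.C D.𝒴 r α}

/-- **Hodge classes are coherent at the place**: every rational class of Hodge type `(r,r)` on `X` lies in the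
`ℂ`-span of the periods of the coherent classes at `D`. -/
def SpansHodge (D : Place n X) : Prop :=
  ∀ (r : ℕ) (c : complexBetti X (2 * r)), IsRationalClass c → IsOfHodgeType n X (2 * r) r r c →
    c ∈ Submodule.span ℂ (D.coherentImage r)

end Place

/-! ### §3 The stubs -/

/-- **STUB 1 (OPEN — the place-package transport of AdelicCoherence's cruxes `DeRhamPlanes` stmt-13697 ∧
`FrobeniusPlanes` stmt-13695, i.e. Ogus's Hopes 4.11.1/4.11.2; known for abelian type, K3, Fermat):** for every smooth
projective complex `X` with a number-field model, at every GENUINE place package the rational `(r,r)`-classes of `X`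
are spanned by the periods of the coherent classes. [cite: Ogus1982, §4 (4.11)] -/
theorem stub_hodgeClassesCoherent :
    ∀ ⦃n : ℕ⦄ ⦃X : SchemeOver ℂ⦄, IsSmoothProjective n X →
      (∃ (K : Type) (_ : Field K) (_ : NumberField K) (σ : K →+* ℂ) (X₀ : SchemeOver K),
        Nonempty (X ≅ (baseChangeHom σ).obj X₀)) →
      ∀ D : Place n X, D.IsGenuine → D.SpansHodge := by
  sorry

/-- **STUB 2 (NEW, OPEN — the card's `NumberFieldSeeds`):** every smooth projective complex `X` with a number-field
model has a GENUINE place package at which every coherent class, in every degree, is seed-spanned (existence of genuine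
packages at almost all places is the classical half; the seeds are the new object statement).
[cite: BlochEsnaultKerz2014pAdic, Thm. 1.3] -/
theorem stub_numberFieldSeeds :
    ∀ ⦃n : ℕ⦄ ⦃X : SchemeOver ℂ⦄, IsSmoothProjective n X →
      (∃ (K : Type) (_ : Field K) (_ : NumberField K) (σ : K →+* ℂ) (X₀ : SchemeOver K),
        Nonempty (X ≅ (baseChangeHom σ).obj X₀)) →
      ∃ D : Place n X, D.IsGenuine ∧ ∀ r : ℕ, CoherentSeedsAt D.C D.𝒴 r := by
  sorry

/-! ### §4 Glue (sorry-free) -/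

section Glue

variable {n : ℕ} {X : SchemeOver ℂ}

/-- **At a genuine place, periods of coherent classes are algebraic, granted seeds and the engine.** -/
theorem Place.coherentImage_subset_algebraicClasses (h1b : PadicPridhamSemiregularity)
    (h1a : FormalLiftingFromClassLifting) (h3a : FormalVectorBundlesAlgebraize)
    (D : Place n X) (hD : D.IsGenuine) (hseeds : ∀ r : ℕ, CoherentSeedsAt D.C D.𝒴 r) (r : ℕ) :
    D.coherentImage r ⊆ (algebraicClasses X r : Set (complexBetti X (2 * r))) := by
  rintro _ ⟨α, hα, rfl⟩
  have hαK : α ∈ Submodule.span K(D.p, D.k)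
      (D.C.dR.ratAlgebraicClasses (genericFibre D.𝒴) r : Set (D.C.dR.obj (genericFibre D.𝒴) (2 * r))) :=
    coherent_mem_span_ratAlgebraicClasses D.C D.hyp.smoothProper (hseeds r)
      (fun E hE hsr hH => liftsTo_of_engine h1b h1a h3a D.C D.bek D.hyp E hE hsr hH) hα
  have h := PadicAnchor.semilinear_apply_mem_span_image (D.cmp (2 * r)) hαK
  refine (Submodule.span_le.mpr ?_) h
  rintro _ ⟨x, hx, rfl⟩
  exact hD.cycleCompatible r x hx

/-- **HC for `X` at a genuine place with coherent Hodge classes and seeds** (the composition at one `X`). -/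
theorem hodgeConjectureFor_of_place (h1b : PadicPridhamSemiregularity)
    (h1a : FormalLiftingFromClassLifting) (h3a : FormalVectorBundlesAlgebraize)
    (hM : Nonempty (HodgeModel n X)) (D : Place n X) (hD : D.IsGenuine) (hS : D.SpansHodge)
    (hseeds : ∀ r : ℕ, CoherentSeedsAt D.C D.𝒴 r) : HodgeConjectureFor n X := by
  refine ⟨hM, fun r c hc hrr => ?_⟩
  exact (Submodule.span_le.mpr (D.coherentImage_subset_algebraicClasses h1b h1a h3a hD hseeds r)) (hS r c hc hrr)

/-- **`QbarEnvelope.HCOverNumberFields` from the two stubs and the engine.** -/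
theorem hcOverNumberFields_of_stubs (h1b : PadicPridhamSemiregularity)
    (h1a : FormalLiftingFromClassLifting) (h3a : FormalVectorBundlesAlgebraize) :
    QbarEnvelope.HCOverNumberFields := by
  intro n X hX hmodel
  obtain ⟨D, hD, hseeds⟩ := stub_numberFieldSeeds hX hmodel
  exact hodgeConjectureFor_of_place h1b h1a h3a (QbarEnvelope.HodgeModels_holds n X hX) D hD
    (stub_hodgeClassesCoherent hX hmodel D hD) hseeds

end Glue

/-! ### §5 The funnel and the composition -/

/-- **The ℚ̄-funnel concludes the crux by name** (QbarEnvelope's deciding theorem restricted off the anchors).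
[cite: Voisin2007HodgeLoci, Prop. 1.7] -/
theorem hodgeBeyondAnchors_of_funnel (hE : QbarEnvelope.Envelope) (hP : QbarEnvelope.PullbackAlgebraic)
    (hM : QbarEnvelope.HodgeModels) (hC : QbarEnvelope.HCOverNumberFields) :
    HodgeBeyondAnchors :=
  fun _ _ hX _ _ => QbarEnvelope.closes hE hC hP hM hX

/-- **THE COMPOSITION.** Granted the registered items — QbarEnvelope's `Envelope` and `PullbackAlgebraic` and this
route's engine P1b, P1a, P3a — the two stubs give the crux `HodgeBeyondAnchors` BY NAME. -/
theorem HodgeBeyondAnchors_of (hE : QbarEnvelope.Envelope) (hP : QbarEnvelope.PullbackAlgebraic)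
    (h1b : PadicPridhamSemiregularity) (h1a : FormalLiftingFromClassLifting)
    (h3a : FormalVectorBundlesAlgebraize) : HodgeBeyondAnchors :=
  hodgeBeyondAnchors_of_funnel hE hP QbarEnvelope.HodgeModels_holds (hcOverNumberFields_of_stubs h1b h1a h3a)

end Summit.HodgeConjecture.HodgeConjecture.Cruxes.HodgeBeyondAnchors.CoherentPlaneObjectEngine

end
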